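import Literature.AnabelianGeometry.SemiGraphs.FiniteEtaleCoveringDictionary
import Literature.AnabelianGeometry.SemiGraphs.GraphOfAnabelioidsComplements
import Literature.AnabelianGeometry.SemiGraphs.SubdivisionLemmas
import Literature.AnabelianGeometry.SemiGraphs.SemiGraphLocal
import Literature.AnabelianGeometry.SemiGraphs.FiniteEtaleCoveringDictionaryProofs3
import Literature.AnabelianGeometry.SemiGraphs.PullbackFunctorExact
import Literature.AnabelianGeometry.SemiGraphs.CoverticialEdgeDescent
import Literature.AnabelianGeometry.Anabelioids.GaloisImages
import HarnessLib

/-!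
# Components of the constituents of `A ∈ B(𝒢)` along a sub-object of `A|_ℍ`: lifting and gluing lemmas ([SemiAnbd] §2, p. 30)

Mochizuki, *Semi-graphs of anabelioids*, Publ. RIMS **42** (2006), §2, proof of Corollary 2.7 (i),
p. 30: along the finite étale covering `𝒢′ → 𝒢` attached to `A ∈ B(𝒢)`, the restriction `ℋ′ → ℍ` to a
sub-semi-graph `ℍ` decomposes into "connected component[s] `ℋ″` of `ℋ′`", each again a (connected)
finite étale covering of `𝒢_ℍ` [cite: MochizukiSemiAnbd2006, Cor. 2.7(i) p.30].

PROOF-ONLY (abc-iut cell, L3 row «D3a», brick M3a part 1, abc-iut-w5-d041, SECOND to abc-iut-L6-t17's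
M1/M2): the tool-kit for the sheet argument proving that the sub-object `Z_K ↪ A|_ℍ` of `B(𝒢_ℍ)`
attached to a preimage component `K` of `φ⁻¹(ℍ)` (abc-iut-L6-t17, `PreimageComponentObject.lean`) is
CONNECTED (`PreimageComponentConnected.lean`, part 2):

* `exists_hom_of_map_mem_range` — in a Galois category, a morphism from a CONNECTED object whose
  fibre-image meets that of a monomorphism factors through it;
* (componentwise isomorphisms / initial objects of `B(𝒢)` are the tree's `BObj.isIso_of_components`,
  `PullbackFunctorExact.lean`, and `BObj.nonempty_isInitial_of_components`,
  `FiniteEtaleCoveringDictionaryProofs3.lean`);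
* `factors_iff_of_gluing_component` — **components correspond along a gluing square**: for a
  sub-object `n : W ↪ A|_ℍ`, a branch `b` of `e ∈ ℍ` abutting to `w ∈ ℍ`, a component `P` of `S_w` and a
  component `Q` of `T_e` lying under `ψ_b(b^* P)` (the position clause of `IsFiniteEtaleCoveringOf`),
  `P` factors through `n_w` iff `Q` factors through `n_e`;
* `factors_eqRec_iff` — invariance of "the component factors through the sub-object" under
  re-presentation of the edge (the position clause as an inclusion of fibre-images at the home edge
  is the tree's `range_subset_of_branchClause`, `CoverticialEdgeDescent.lean`).

No definitions; nothing here takes a side on [IUTchIII] Cor. 3.12.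
-/

namespace Literature.AnabelianGeometry.SemiGraphs

open CategoryTheory CategoryTheory.Limits CategoryTheory.PreGaloisCategory
open Literature.AnabelianGeometry.Anabelioids

universe w v₁ u₁ u

/-! ### A lifting lemma in a Galois category -/

/-- **Lifting along a monomorphism from a connected object.**  In a Galois category with fibre
functor `F`: if `a : P ⟶ X` has connected source and its fibre-image MEETS the fibre-image of a
monomorphism `n : W ↪ X`, then `a` factors through `n`.  (The pull-back `P ×_X W ↪ P` is a
monomorphism with non-empty fibre into a connected object, hence an isomorphism.)
[cite: MochizukiSemiAnbd2006, Def. 2.2(i) p.23] -/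
theorem exists_hom_of_map_mem_range {C : Type u₁} [Category.{v₁} C] [GaloisCategory C]
    (F : C ⥤ FintypeCat.{w}) [FiberFunctor F] {P W X : C} [IsConnected P] (a : P ⟶ X)
    (n : W ⟶ X) [Mono n] {p : F.obj P} (h : F.map a p ∈ Set.range (F.map n)) :
    ∃ f : P ⟶ W, f ≫ n = a := by
  obtain ⟨x, hx⟩ := h
  let y : F.obj (pullback a n) := (fiberPullbackEquiv F a n).symm ⟨(p, x), hx.symm⟩
  have hn : IsInitial (pullback a n) → False := not_initial_of_inhabited F y
  haveI : IsIso (pullback.fst a n) := IsConnected.noTrivialComponent _ (pullback.fst a n) hn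
  refine ⟨inv (pullback.fst a n) ≫ pullback.snd a n, ?_⟩
  rw [Category.assoc, ← pullback.condition, IsIso.inv_hom_id_assoc]

namespace SemiGraphOfAnabelioids

variable {𝒢 𝒢' : SemiGraphOfAnabelioids.{v₁, u₁, u}}

/-! ### Components correspond along a gluing square -/

/-- Fibre-images through an isomorphism: `x ∈ F(g ≫ ψ)` iff `F(ψ⁻¹) x ∈ F(g)`.
[cite: MochizukiSemiAnbd2006, Def. 2.1 p.23] -/
theorem mem_range_map_comp_iso_iff {C : Type u₁} [Category.{v₁} C] (F : C ⥤ FintypeCat.{w})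
    {X Y Z : C} (g : X ⟶ Y) (ψ : Y ≅ Z) (x : F.obj Z) :
    x ∈ Set.range (F.map (g ≫ ψ.hom)) ↔ F.map ψ.inv x ∈ Set.range (F.map g) := by
  have hw : ∀ y, F.map ψ.inv (F.map ψ.hom y) = y := fun y =>
    FintypeCat.hom_inv_id_apply (F.mapIso ψ) y
  have hw' : ∀ z, F.map ψ.hom (F.map ψ.inv z) = z := fun z =>
    FintypeCat.inv_hom_id_apply (F.mapIso ψ) z
  constructor
  · rintro ⟨z, rfl⟩
    exact ⟨z, by rw [Functor.map_comp, FintypeCat.comp_apply, hw]⟩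
  · rintro ⟨z, hz⟩
    exact ⟨z, by rw [Functor.map_comp, FintypeCat.comp_apply, hz, hw']⟩

/-- **Components correspond along a gluing square** (the component analogue of the sheet lemma
`factors_iff_of_gluing` of `GraphCoveringConnected.lean`).  Let `ℍ ⊆ 𝔾`, `A ∈ B(𝒢)`, and
`n : W ↪ A|_ℍ` a monomorphism of `B(𝒢_ℍ)`; let `b` be a branch of the edge `e ∈ ℍ` abutting to the
vertex `w ∈ ℍ`, `P` a connected component of `S_w` and `Q` a connected component of `T_e` LYING UNDER
`ψ_b(b^* P)` (the position clause of `IsFiniteEtaleCoveringOf` for a branch of the covering over `b`).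
Then `P ↪ S_w` factors through `n_w` iff `Q ↪ T_e` factors through `n_e`: read both on the fibre
functors `b^* ⋙ F_e`, `F_e` through the gluing square of `n` at `b` and lift with
`exists_hom_of_map_mem_range`. [cite: MochizukiSemiAnbd2006, Cor. 2.7(i) p.30] -/
theorem factors_iff_of_gluing_component (H : 𝒢.graph.Subgraph) (A : 𝒢.BObj)
    {W : (𝒢.restrict H).BObj} (n : W ⟶ (𝒢.restrictFunctor H).obj A) [Mono n]
    (b : 𝒢.graph.Branch) (heH : 𝒢.graph.edgeOf b ∈ H.edges) (w : 𝒢.graph.Vertex)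
    (hwH : w ∈ H.verts) (h : 𝒢.graph.abuts b = some w)
    (P : π₀Obj (A.S w)) (Q : π₀Obj (A.T (𝒢.graph.edgeOf b)))
    (Fe : 𝒢.E (𝒢.graph.edgeOf b) ⥤ FintypeCat.{v₁}) [FiberFunctor Fe]
    (hPQ : Set.range (Fe.map Q.1.arrow) ⊆
      Set.range (Fe.map ((𝒢.pull b w h).pullback.map P.1.arrow ≫ (A.ψ b w h).hom))) :
    (∃ f : (P.1 : 𝒢.V w) ⟶ W.S ⟨w, hwH⟩, f ≫ n.fS ⟨w, hwH⟩ = P.1.arrow) ↔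
      ∃ g : (Q.1 : 𝒢.E (𝒢.graph.edgeOf b)) ⟶ W.T ⟨𝒢.graph.edgeOf b, heH⟩,
        g ≫ n.fT ⟨𝒢.graph.edgeOf b, heH⟩ = Q.1.arrow := by
  haveI : PreGaloisCategory.IsConnected (P.1 : 𝒢.V w) := P.2
  haveI : PreGaloisCategory.IsConnected (Q.1 : 𝒢.E (𝒢.graph.edgeOf b)) := Q.2
  -- the fibre functor `b^* ⋙ F_e` of `𝒢_w`
  let Pb := (𝒢.pull b w h).pullback
  let F' : 𝒢.V w ⥤ FintypeCat.{v₁} := Pb ⋙ Fe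
  haveI : FiberFunctor F' := fiberFunctor_comp_of_exact _ _
  -- the branch `b` and the vertex `w` as data of `ℍ`, and the gluing square of `n` there
  have hβ : H.toSemiGraph.abuts ⟨b, heH⟩ = some ⟨w, hwH⟩ :=
    (SemiGraph.Subgraph.abuts_eq_some_iff H _ _).mpr h
  -- names for the morphisms involved, in the categories `𝒢_w` and `𝒢_e`
  let WS : 𝒢.V w := W.S ⟨w, hwH⟩
  let WT : 𝒢.E (𝒢.graph.edgeOf b) := W.T ⟨𝒢.graph.edgeOf b, heH⟩
  let nS : (P.1 : 𝒢.V w) ⟶ A.S w := P.1.arrow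
  let nW : WS ⟶ A.S w := n.fS ⟨w, hwH⟩
  let nT : WT ⟶ A.T (𝒢.graph.edgeOf b) := n.fT ⟨𝒢.graph.edgeOf b, heH⟩
  haveI : Mono nW := (𝒢.restrict H).mono_fS n ⟨w, hwH⟩
  haveI : Mono nT := (𝒢.restrict H).mono_fT n ⟨𝒢.graph.edgeOf b, heH⟩
  let ψA : Pb.obj (A.S w) ≅ A.T (𝒢.graph.edgeOf b) := A.ψ b w h
  let ψW : Pb.obj WS ≅ WT := W.ψ ⟨b, heH⟩ ⟨w, hwH⟩ hβ
  have hsq : Pb.map nW ≫ ψA.hom = ψW.hom ≫ nT := n.comm ⟨b, heH⟩ ⟨w, hwH⟩ hβ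
  -- (a) pointwise form of the square and the inverse identities
  have hsq' : ∀ z', Fe.map ψA.hom (Fe.map (Pb.map nW) z') = Fe.map nT (Fe.map ψW.hom z') := by
    intro z'
    have e1 : Fe.map (Pb.map nW ≫ ψA.hom) = Fe.map (Pb.map nW) ≫ Fe.map ψA.hom := Fe.map_comp _ _
    have e2 : Fe.map (ψW.hom ≫ nT) = Fe.map ψW.hom ≫ Fe.map nT := Fe.map_comp _ _
    have := ConcreteCategory.congr_hom (e1.symm.trans ((congrArg Fe.map hsq).trans e2)) z'
    simpa only [FintypeCat.comp_apply] using this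
  have hAψ : ∀ y, Fe.map ψA.inv (Fe.map ψA.hom y) = y := fun y =>
    FintypeCat.hom_inv_id_apply (Fe.mapIso ψA) y
  have hAψ' : ∀ x, Fe.map ψA.hom (Fe.map ψA.inv x) = x := fun x =>
    FintypeCat.inv_hom_id_apply (Fe.mapIso ψA) x
  have hWψ' : ∀ z, Fe.map ψW.hom (Fe.map ψW.inv z) = z := fun z =>
    FintypeCat.inv_hom_id_apply (Fe.mapIso ψW) z
  -- the fibre-image of `n_e` is `ψ_b` of the fibre-image of `b^* n_w`
  have hrange_n : ∀ x : Fe.obj (A.T (𝒢.graph.edgeOf b)),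
      x ∈ Set.range (Fe.map nT) ↔ Fe.map ψA.inv x ∈ Set.range (Fe.map (Pb.map nW)) := by
    intro x
    constructor
    · rintro ⟨z, rfl⟩
      refine ⟨Fe.map ψW.inv z, ?_⟩
      calc Fe.map (Pb.map nW) (Fe.map ψW.inv z)
          = Fe.map ψA.inv (Fe.map ψA.hom (Fe.map (Pb.map nW) (Fe.map ψW.inv z))) := (hAψ _).symm
        _ = Fe.map ψA.inv (Fe.map nT (Fe.map ψW.hom (Fe.map ψW.inv z))) := by rw [hsq']
        _ = Fe.map ψA.inv (Fe.map nT z) := by rw [hWψ']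
    · rintro ⟨z', hz'⟩
      refine ⟨Fe.map ψW.hom z', ?_⟩
      calc Fe.map nT (Fe.map ψW.hom z') = Fe.map ψA.hom (Fe.map (Pb.map nW) z') := (hsq' z').symm
        _ = Fe.map ψA.hom (Fe.map ψA.inv x) := by rw [hz']
        _ = x := hAψ' x
  -- (b) the position clause: `Q` lies under `ψ_b(b^* P)`
  have hPQ' : ∀ x, x ∈ Set.range (Fe.map Q.1.arrow) →
      Fe.map ψA.inv x ∈ Set.range (F'.map nS) := fun x hx =>
    (mem_range_map_comp_iso_iff Fe (Pb.map nS) ψA x).mp (hPQ hx)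
  -- a point of the fibre of the connected `Q`, and the point of `b^* P` under it
  obtain ⟨q⟩ := nonempty_fiber_of_isConnected Fe (Q.1 : 𝒢.E (𝒢.graph.edgeOf b))
  obtain ⟨p, hp⟩ := hPQ' (Fe.map Q.1.arrow q) ⟨q, rfl⟩
  constructor
  · rintro ⟨f, hf⟩
    -- `F_e(Q) q` lies in `F_e(n_e)` because `ψ_b⁻¹` of it lies in `b^* P ⊆ b^* n_w`
    have hfp : F'.map nW (F'.map f p) = F'.map nS p := by
      have e1 : F'.map (f ≫ nW) = F'.map f ≫ F'.map nW := F'.map_comp _ _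
      have hf' : f ≫ nW = nS := hf
      have := ConcreteCategory.congr_hom e1 p
      rw [hf'] at this
      simpa only [FintypeCat.comp_apply] using this.symm
    have hx : Fe.map Q.1.arrow q ∈ Set.range (Fe.map nT) := by
      rw [hrange_n, ← hp]
      exact ⟨F'.map f p, hfp⟩
    exact exists_hom_of_map_mem_range Fe Q.1.arrow nT hx
  · rintro ⟨g, hg⟩
    have hgq : Fe.map nT (Fe.map g q) = Fe.map Q.1.arrow q := by
      have e1 : Fe.map (g ≫ nT) = Fe.map g ≫ Fe.map nT := Fe.map_comp _ _
      have hg' : g ≫ nT = Q.1.arrow := hg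
      have := ConcreteCategory.congr_hom e1 q
      rw [hg'] at this
      simpa only [FintypeCat.comp_apply] using this.symm
    have hx : Fe.map Q.1.arrow q ∈ Set.range (Fe.map nT) := ⟨Fe.map g q, hgq⟩
    have hp' : F'.map nS p ∈ Set.range (F'.map nW) := by
      rw [hp]
      exact (hrange_n _).mp hx
    exact exists_hom_of_map_mem_range F' nS nW hp'

/-! ### Re-presentation of the edge (the position clause itself is `range_subset_of_branchClause`,
`CoverticialEdgeDescent.lean`) -/

/-- Factorisation of a transported component through a sub-object of `B(𝒢_ℍ)` does not depend on the
presentation of the edge. [cite: MochizukiSemiAnbd2006, Def. 2.2(i) p.23] -/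
theorem factors_eqRec_iff (H : 𝒢.graph.Subgraph) (A : 𝒢.BObj) {W : (𝒢.restrict H).BObj}
    (n : W ⟶ (𝒢.restrictFunctor H).obj A) {e₁ e₂ : 𝒢.graph.Edge} (he : e₁ = e₂) (h₁ : e₁ ∈ H.edges)
    (h₂ : e₂ ∈ H.edges) (Q : π₀Obj (A.T e₂)) :
    (∃ g : ((he ▸ Q : π₀Obj (A.T e₁)).1 : 𝒢.E e₁) ⟶ W.T ⟨e₁, h₁⟩,
        g ≫ n.fT ⟨e₁, h₁⟩ = (he ▸ Q : π₀Obj (A.T e₁)).1.arrow) ↔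
      ∃ g : (Q.1 : 𝒢.E e₂) ⟶ W.T ⟨e₂, h₂⟩, g ≫ n.fT ⟨e₂, h₂⟩ = Q.1.arrow := by
  subst he
  exact Iff.rfl

end SemiGraphOfAnabelioids

end Literature.AnabelianGeometry.SemiGraphs
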